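import Literature.MathematicalPhysics.StatisticalMechanics.CrystallizationSymmetries
import Literature.MathematicalPhysics.StatisticalMechanics.LennardJonesClusters
import Mathlib.Topology.Algebra.InfiniteSum.Basic
import Mathlib.Topology.MetricSpace.Isometry
import Mathlib.Analysis.Normed.Group.AddTorsor
import HarnessLib

/-!
# Hard-core (distinct-points) canonical ground state configurations

Topic: `Literature/MathematicalPhysics/StatisticalMechanics`. Definition request `defn-IsHardCoreGSC`
(route `AtomisticToContinuum/Crystallization/GscTwinLoopSurgery`, items `LocalLimitStable`,
`LayeredWindows`, `TwinLoopLemma`, `HcpPerfectWindows`, which inline the notion verbatim with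
`V = lennardJones`, `d = 3`; the definition below unfolds to that text by `Iff.rfl`).

## Content

* `IsHardCoreGSC V X` — **the point set `X ⊆ ℝᵈ` is a (canonical) ground state configuration of
  the radial pair potential `V`, in the hard-core / distinct-points convention**: Sütő's
  canonical GSC (Sütő 2011, §7, Definition 7.1 = Definition 4 of arXiv:1004.5260; Sütő 2006, §2,
  Definition, second form: "`X` is a GSC if for any finite part `X_f` of `X` and any `R` such that
  `N_R = N_{X_f}`: `U(R|X∖X_f) ≥ U(X_f|X∖X_f)`", `U(R|Y) = U(R) + I(R, Y)`,
  `I(R, Y) = ∑_{r ∈ R} ∑_{y ∈ Y} φ(r − y)`) — "a locally stable configuration, in the sense that no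
  local modification can decrease its energy" — transposed to the conventions of
  `Crystallization.lean`: radial potential `φ(x) = V(|x|)`, `U = interactionEnergy V`
  (`∑_{i<j} V(|Rᵢ − Rⱼ|)`), and DISTINCT POINTS in place of `V(0) = +∞` (the removed part `X_f` is
  `n` distinct points `y` of the set `X`, the inserted part is `n` distinct points `z` avoiding
  `X ∖ X_f`), exactly as in `groundStateEnergy` / `IsGroundState` and in the `μ`GSC notion
  `IsMuGSC` of this topic (of which this is the particle-conserving slice `k = n`, without the
  `μ`-terms, which cancel, and without the convergence clause, see below).
* API: the unfolding lemma `isHardCoreGSC_iff`; `IsHardCoreGSC.le`; `IsHardCoreGSC.of_mu` ("a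
  `μ`GSC is, by definition, also a GSC", Sütő 2006, Remark 4 — stated on the unfolded `μ`GSC
  inequalities, so that it applies to `IsMuGSC` by `h.2`); `IsHardCoreGSC.one_point` (moving one
  particle never lowers its field energy); sets with at most one point are hard-core GSCs
  (`isHardCoreGSC_of_subsingleton`, non-vacuity); invariance under isometries of `ℝᵈ`
  (`IsHardCoreGSC.image_isometryEquiv`, `isHardCoreGSC_image_isometryEquiv_iff`, and the
  `p ↦ A p + v` form `IsHardCoreGSC.image_linearIsometryEquiv_add` used by the route's glue);
  and the consistency check with the finite-volume notion of `Crystallization.lean`: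
  **the point set of a finite ground state is a hard-core GSC**
  (`IsGroundState.isHardCoreGSC_range`, energies bounded below; `…_of_le` for `V ≥ c`, e.g.
  Lennard-Jones), through the exchange identity `two_mul_interactionEnergy_exchange`
  (`2𝓔_N` of the competitor `(X ∖ y) ∪ z` versus `2𝓔_N(x)`).

## Design choices and wording risks

* **Hard core = distinct points.** Sütő works with point SEQUENCES because "particles can be
  placed in the same point if the interaction is bounded" (2011, §7); for potentials diverging at
  the origin (Lennard-Jones) coincidences have infinite printed energy, and the tree's convention
  (configurations are injective, the infinite configuration is a SET) is the faithful reading: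
  `y` injective with `range y ⊆ X`, `z` injective with `range z` disjoint from `X ∖ range y`
  (a new point may sit where a removed one was). Sütő 2011, §7: "The above definition … appl[ies]
  also to interactions that are not integrable at the origin or have a hard core."
* **No convergence clause.** Sütő's Definition 7.1 makes "U(X_f) finite, I(X_f, X∖X_f)
  absolutely convergent" part of the definition. The requesting route states the notion WITHOUT
  it (its configurations are uniformly discrete local limits of Lennard-Jones ground states, whose
  fields are summable — `UniformlyDiscrete.summable_lennardJones_dist` in this topic), and so does
  `IsHardCoreGSC`: the field terms are unconditional sums `∑'` (value `0` on a non-summable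
  family). On configurations with summable fields the two readings agree; in general
  `IsHardCoreGSC` is the bare stability inequality of the source.
* The same `n` on both sides is the source's `N_R = N_{X_f}` (canonical = particle-conserving).
  The grand-canonical notion is `IsMuGSC` (files `MuGSC.lean` / `MuGroundStateConfiguration.lean`,
  not imported here); the sequence-and-vector-potential version for bounded `φ` is
  `Literature.Barriers.AtomisticToContinuum.Suto.IsGSC`.

## Sources

* A. Sütő, *Ground state at high density*, Comm. Math. Phys. 305 (2011) 657–710,
  arXiv:1004.5260: §7 "Ground state configurations in infinite space", Definition 7.1
  (Definition 4 in the arXiv numbering): `μ`GSC and (canonical) GSC, and the sentence following it.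
* A. Sütő, Phys. Rev. B 74 (2006) 104117, arXiv:math-ph/0608041: §2, Definition (GSC, both
  forms; arXiv p. 5) and Remark 4 (a `μ`GSC is a GSC; arXiv p. 7).
-/

noncomputable section

open scoped BigOperators
open Set

namespace Literature.MathematicalPhysics.StatisticalMechanics

variable {d : ℕ}

/-- **Hard-core canonical ground state configuration.** The point set `X ⊆ ℝᵈ` is a ground state
configuration of the radial pair potential `V` in the canonical (particle-conserving) sense and
the distinct-points convention: for every `n`, every `n` distinct points `y` of `X` (the finite
part `X_f = range y`) and every `n` distinct new positions `z` avoiding `X ∖ X_f`,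
`U(y) + I(y, X ∖ X_f) ≤ U(z) + I(z, X ∖ X_f)`, where `U = interactionEnergy V` and
`I(w, Y) = ∑ᵢ ∑'_{q ∈ Y} V(|wᵢ − q|)` — "for any finite part `X_f` of `X` and any `R` such that
`N_R = N_{X_f}`: `U(R|X∖X_f) ≥ U(X_f|X∖X_f)`" (Sütő); no convergence clause (the field sums are
unconditional `∑'`). [cite: Suto2011, §7 Definition 7.1 (GSC; arXiv:1004.5260 Definition 4)] -/
def IsHardCoreGSC (V : ℝ → ℝ) (X : Set (EuclideanSpace ℝ (Fin d))) : Prop :=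
  ∀ (n : ℕ) (y z : Fin n → EuclideanSpace ℝ (Fin d)), Function.Injective y →
    Function.Injective z → Set.range y ⊆ X → Disjoint (Set.range z) (X \ Set.range y) →
      interactionEnergy V y + ∑ i, ∑' q : ↥(X \ Set.range y), V (dist (y i) q) ≤
        interactionEnergy V z + ∑ i, ∑' q : ↥(X \ Set.range y), V (dist (z i) q)

/-- Unfolding lemma: `IsHardCoreGSC V X` is, by `Iff.rfl`, the text inlined in route
`GscTwinLoopSurgery` (there with `V = lennardJones`, `d = 3`). [folklore] -/
theorem isHardCoreGSC_iff (V : ℝ → ℝ) (X : Set (EuclideanSpace ℝ (Fin d))) :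
    IsHardCoreGSC V X ↔
      ∀ (n : ℕ) (y z : Fin n → EuclideanSpace ℝ (Fin d)), Function.Injective y →
        Function.Injective z → Set.range y ⊆ X → Disjoint (Set.range z) (X \ Set.range y) →
          interactionEnergy V y +
                ∑ i, ∑' q : ↥(X \ Set.range y), V (dist (y i) (q : EuclideanSpace ℝ (Fin d))) ≤
            interactionEnergy V z +
                ∑ i, ∑' q : ↥(X \ Set.range y), V (dist (z i) (q : EuclideanSpace ℝ (Fin d))) :=
  Iff.rfl

namespace IsHardCoreGSC

variable {V : ℝ → ℝ} {X : Set (EuclideanSpace ℝ (Fin d))}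

/-- The defining stability inequality of a hard-core GSC under the exchange of the `n` points `y`
of `X` for the `n` new points `z`. [cite: Suto2011, §7 Definition 7.1 (GSC)] -/
theorem le (h : IsHardCoreGSC V X) {n : ℕ} {y z : Fin n → EuclideanSpace ℝ (Fin d)}
    (hy : Function.Injective y) (hz : Function.Injective z) (hyX : Set.range y ⊆ X)
    (hdisj : Disjoint (Set.range z) (X \ Set.range y)) :
    interactionEnergy V y + ∑ i, ∑' q : ↥(X \ Set.range y), V (dist (y i) q) ≤
      interactionEnergy V z + ∑ i, ∑' q : ↥(X \ Set.range y), V (dist (z i) q) :=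
  h n y z hy hz hyX hdisj

/-- **A `μ`GSC is a GSC** ("by definition, because it satisfies a stronger condition"): if no
finite modification `X_f ↦ R` with ARBITRARY particle numbers lowers `U − μ·#` (the inequalities
of `IsMuGSC V μ X`, unfolded), then in particular no particle-conserving one lowers `U`.
[cite: Suto2006, §2 Remark 4] -/
theorem of_mu {μ : ℝ}
    (h : ∀ (n : ℕ) (xf : Fin n → EuclideanSpace ℝ (Fin d)), Function.Injective xf →
      Set.range xf ⊆ X → ∀ (k : ℕ) (R : Fin k → EuclideanSpace ℝ (Fin d)),
        Function.Injective R → Disjoint (Set.range R) (X \ Set.range xf) →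
          interactionEnergy V xf + (∑ i, ∑' q : ↥(X \ Set.range xf), V (dist (xf i) q)) - μ * n ≤
            interactionEnergy V R + (∑ i, ∑' q : ↥(X \ Set.range xf), V (dist (R i) q)) - μ * k) :
    IsHardCoreGSC V X := fun n y z hy hz hyX hdisj => by
  have := h n y hy hyX n z hz hdisj
  linarith

/-- **One-particle moves.** In a hard-core GSC, moving a single particle `p ∈ X` to a new
position `r` not occupied by another particle never lowers its energy in the field of the
others: `∑'_{q ∈ X∖{p}} V(|p − q|) ≤ ∑'_{q ∈ X∖{p}} V(|r − q|)` (the case `n = 1`).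
[cite: Suto2011, §7 Definition 7.1 (GSC), case |X_f| = 1] -/
theorem one_point (h : IsHardCoreGSC V X) {p r : EuclideanSpace ℝ (Fin d)} (hp : p ∈ X)
    (hr : r ∉ X \ {p}) :
    ∑' q : ↥(X \ {p}), V (dist p q) ≤ ∑' q : ↥(X \ {p}), V (dist r q) := by
  have key := h.le (n := 1) (y := fun _ => p) (z := fun _ => r)
    (Function.injective_of_subsingleton _) (Function.injective_of_subsingleton _)
    (by rw [Set.range_const]; exact Set.singleton_subset_iff.2 hp)
    (by rw [Set.range_const, Set.range_const]; exact Set.disjoint_singleton_left.2 hr)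
  rw [interactionEnergy_of_subsingleton, interactionEnergy_of_subsingleton, Set.range_const] at key
  simpa using key

end IsHardCoreGSC

section Subsingleton

variable {V : ℝ → ℝ} {X : Set (EuclideanSpace ℝ (Fin d))}

/-- A configuration with at most one point is a hard-core GSC of every potential: there is no
pair to interact and nothing left to interact with (non-vacuity of the notion). [folklore] -/
theorem isHardCoreGSC_of_subsingleton (hX : X.Subsingleton) : IsHardCoreGSC V X := by
  intro n y z hy _ hyX _
  haveI : Subsingleton (Fin n) :=
    ⟨fun i j => hy (hX (hyX (Set.mem_range_self i)) (hyX (Set.mem_range_self j)))⟩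
  have h0 : ∀ w : Fin n → EuclideanSpace ℝ (Fin d),
      ∑ i, ∑' q : ↥(X \ Set.range y), V (dist (w i) q) = 0 := by
    intro w
    refine Finset.sum_eq_zero fun i _ => ?_
    haveI : IsEmpty ↥(X \ Set.range y) :=
      ⟨fun q => q.2.2 ⟨i, hX (hyX (Set.mem_range_self i)) q.2.1⟩⟩
    exact tsum_empty
  rw [h0 y, h0 z, interactionEnergy_of_subsingleton, interactionEnergy_of_subsingleton]

/-- The vacuum is a hard-core GSC. [folklore] -/
theorem isHardCoreGSC_empty : IsHardCoreGSC V (∅ : Set (EuclideanSpace ℝ (Fin d))) :=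
  isHardCoreGSC_of_subsingleton Set.subsingleton_empty

/-- A single particle is a hard-core GSC. [folklore] -/
theorem isHardCoreGSC_singleton (p : EuclideanSpace ℝ (Fin d)) : IsHardCoreGSC V {p} :=
  isHardCoreGSC_of_subsingleton Set.subsingleton_singleton

end Subsingleton

/-! ## Invariance under isometries of `ℝᵈ` -/

section Isometry

variable {V : ℝ → ℝ} {X : Set (EuclideanSpace ℝ (Fin d))}

/-- **Isometry invariance.** The image of a hard-core GSC under a (bijective) isometry of `ℝᵈ` —
translations, rotations, reflexions and their composites — is a hard-core GSC: energies and
field sums only involve mutual distances. [folklore] -/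
theorem IsHardCoreGSC.image_isometryEquiv (h : IsHardCoreGSC V X)
    (A : EuclideanSpace ℝ (Fin d) ≃ᵢ EuclideanSpace ℝ (Fin d)) : IsHardCoreGSC V (A '' X) := by
  intro n y z hy hz hyX hdisj
  -- write the test configurations as images of configurations on the `X` side
  obtain ⟨y, rfl⟩ : ∃ y' : Fin n → EuclideanSpace ℝ (Fin d), y = A ∘ y' :=
    ⟨A.symm ∘ y, funext fun i => (A.apply_symm_apply (y i)).symm⟩
  obtain ⟨z, rfl⟩ : ∃ z' : Fin n → EuclideanSpace ℝ (Fin d), z = A ∘ z' :=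
    ⟨A.symm ∘ z, funext fun i => (A.apply_symm_apply (z i)).symm⟩
  have hy' : Function.Injective y := (A.injective.of_comp_iff y).1 hy
  have hz' : Function.Injective z := (A.injective.of_comp_iff z).1 hz
  have hS : A '' X \ Set.range (A ∘ y) = A '' (X \ Set.range y) := by
    rw [Set.range_comp, ← Set.image_sdiff A.injective]
  have hyX' : Set.range y ⊆ X := fun q hq =>
    A.injective.mem_set_image.1 (hyX (by rw [Set.range_comp]; exact Set.mem_image_of_mem A hq))
  have hdisj' : Disjoint (Set.range z) (X \ Set.range y) := by
    rw [hS, Set.range_comp] at hdisj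
    exact (Set.disjoint_image_iff A.injective).1 hdisj
  have hfield : ∀ w : Fin n → EuclideanSpace ℝ (Fin d),
      ∑ i, ∑' q : ↥(A '' X \ Set.range (A ∘ y)), V (dist ((A ∘ w) i) q) =
        ∑ i, ∑' q : ↥(X \ Set.range y), V (dist (w i) q) := by
    intro w
    refine Finset.sum_congr rfl fun i _ => ?_
    rw [tsum_congr_set_coe (fun q => V (dist ((A ∘ w) i) q)) hS,
      tsum_image (fun q => V (dist ((A ∘ w) i) q)) A.injective.injOn]
    simp only [Function.comp_apply, IsometryEquiv.dist_eq]
  rw [interactionEnergy_comp_isometry V A.isometry, interactionEnergy_comp_isometry V A.isometry,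
    hfield, hfield]
  exact h.le hy' hz' hyX' hdisj'

/-- A set is a hard-core GSC iff its image under an isometry of `ℝᵈ` is. [folklore] -/
theorem isHardCoreGSC_image_isometryEquiv_iff
    (A : EuclideanSpace ℝ (Fin d) ≃ᵢ EuclideanSpace ℝ (Fin d)) :
    IsHardCoreGSC V (A '' X) ↔ IsHardCoreGSC V X := by
  refine ⟨fun h => ?_, fun h => h.image_isometryEquiv A⟩
  simpa only [Set.image_image, IsometryEquiv.symm_apply_apply, Set.image_id'] using
    h.image_isometryEquiv A.symm

/-- Translates of hard-core GSCs are hard-core GSCs. [folklore] -/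
theorem IsHardCoreGSC.image_add_const (h : IsHardCoreGSC V X) (v : EuclideanSpace ℝ (Fin d)) :
    IsHardCoreGSC V ((fun p => p + v) '' X) :=
  h.image_isometryEquiv (IsometryEquiv.addRight v)

/-- Images of hard-core GSCs under linear isometries followed by translations, `p ↦ A p + v`
(the form in which route `GscTwinLoopSurgery` moves configurations), are hard-core GSCs.
[folklore] -/
theorem IsHardCoreGSC.image_linearIsometryEquiv_add (h : IsHardCoreGSC V X)
    (A : EuclideanSpace ℝ (Fin d) ≃ₗᵢ[ℝ] EuclideanSpace ℝ (Fin d)) (v : EuclideanSpace ℝ (Fin d)) :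
    IsHardCoreGSC V ((fun p => A p + v) '' X) :=
  h.image_isometryEquiv (A.toIsometryEquiv.trans (IsometryEquiv.addRight v))

end Isometry

/-! ## Finite ground states are hard-core GSCs of their own point set -/

section GroundState

variable (V : ℝ → ℝ) {N : ℕ}

/-- Twice the interaction energy as the full double sum minus its diagonal:
`2 𝓔_N(x) = ∑ᵢ ∑ₖ V(|xᵢ − x_k|) − N · V(0)` (cf. `two_mul_interactionEnergy_eq_sum_sum`, the case
`V 0 = 0`). [folklore] -/
theorem two_mul_interactionEnergy_eq_sum_sum_sub (x : Fin N → EuclideanSpace ℝ (Fin d)) :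
    2 * interactionEnergy V x = ∑ i, ∑ k, V (dist (x i) (x k)) - N * V 0 := by
  rw [two_mul_interactionEnergy]
  have h : ∀ i, siteEnergy V x i = ∑ k, V (dist (x i) (x k)) - V 0 := fun i => by
    rw [siteEnergy, Finset.sum_erase_eq_sub (Finset.mem_univ i), dist_self]
  simp only [h, Finset.sum_sub_distrib, Finset.sum_const, Finset.card_univ, Fintype.card_fin,
    nsmul_eq_mul]

/-- **Exchange bookkeeping.** If the configuration `u : Fin N → ℝᵈ` carries the points `w` on
the indices `e(Fin n)` and agrees with `x` off them, then
`2 𝓔_N(u) = 2 𝓔_n(w) + 2 ∑ₐ ∑_{j ∉ e(Fin n)} V(|wₐ − xⱼ|) + (terms not involving w)`. [folklore] -/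
theorem two_mul_interactionEnergy_exchange {n : ℕ} (x u : Fin N → EuclideanSpace ℝ (Fin d))
    (w : Fin n → EuclideanSpace ℝ (Fin d)) (e : Fin n ↪ Fin N) (hon : ∀ a, u (e a) = w a)
    (hoff : ∀ j, j ∉ Finset.univ.map e → u j = x j) :
    2 * interactionEnergy V u =
      2 * interactionEnergy V w + 2 * ∑ a, ∑ j ∈ (Finset.univ.map e)ᶜ, V (dist (w a) (x j)) +
        (∑ j ∈ (Finset.univ.map e)ᶜ, ∑ k ∈ (Finset.univ.map e)ᶜ, V (dist (x j) (x k)) -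
          ((N : ℝ) - n) * V 0) := by
  rw [two_mul_interactionEnergy_eq_sum_sum_sub V u, two_mul_interactionEnergy_eq_sum_sum_sub V w,
    sum_sum_eq_add_compl (fun i k => V (dist (u i) (u k))) (Finset.univ.map e)]
  have hTT : ∑ i ∈ Finset.univ.map e, ∑ k ∈ Finset.univ.map e, V (dist (u i) (u k)) =
      ∑ a, ∑ b, V (dist (w a) (w b)) := by
    simp only [Finset.sum_map, hon]
  have hTC : ∑ i ∈ Finset.univ.map e, ∑ k ∈ (Finset.univ.map e)ᶜ, V (dist (u i) (u k)) =
      ∑ a, ∑ k ∈ (Finset.univ.map e)ᶜ, V (dist (w a) (x k)) := by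
    rw [Finset.sum_map]
    exact Finset.sum_congr rfl fun a _ => Finset.sum_congr rfl fun k hk => by
      rw [hon, hoff k (Finset.mem_compl.1 hk)]
  have hCT : ∑ i ∈ (Finset.univ.map e)ᶜ, ∑ k ∈ Finset.univ.map e, V (dist (u i) (u k)) =
      ∑ a, ∑ k ∈ (Finset.univ.map e)ᶜ, V (dist (w a) (x k)) := by
    rw [Finset.sum_comm (s := (Finset.univ.map e)ᶜ) (t := Finset.univ.map e), Finset.sum_map]
    exact Finset.sum_congr rfl fun a _ => Finset.sum_congr rfl fun k hk => by
      rw [hon, hoff k (Finset.mem_compl.1 hk), dist_comm]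
  have hCC : ∑ i ∈ (Finset.univ.map e)ᶜ, ∑ k ∈ (Finset.univ.map e)ᶜ, V (dist (u i) (u k)) =
      ∑ i ∈ (Finset.univ.map e)ᶜ, ∑ k ∈ (Finset.univ.map e)ᶜ, V (dist (x i) (x k)) :=
    Finset.sum_congr rfl fun i hi => Finset.sum_congr rfl fun k hk => by
      rw [hoff i (Finset.mem_compl.1 hi), hoff k (Finset.mem_compl.1 hk)]
  rw [hTT, hTC, hCT, hCC]
  ring

/-- **Finite ground states are hard-core GSCs.** If `x = (x₁, …, x_N)` minimises `𝓔_N` among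
configurations of `N` distinct points (`IsGroundState V x`, the energies of such configurations
being bounded below), then its point set `{x₁, …, x_N} ⊆ ℝᵈ`, viewed as a configuration in
infinite space, is a hard-core GSC of `V`: exchanging the particles `y` for `z` produces the
competitor `(X ∖ y) ∪ z` of `N` distinct points, whose energy exceeds `𝓔_N(x) = E(N)` by exactly
`[U(z) + I(z, X ∖ y)] − [U(y) + I(y, X ∖ y)]` (`two_mul_interactionEnergy_exchange`). [folklore] -/
theorem IsGroundState.isHardCoreGSC_range {x : Fin N → EuclideanSpace ℝ (Fin d)}
    (hb : BddBelow (Set.range fun x : {x : Fin N → EuclideanSpace ℝ (Fin d) //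
      Function.Injective x} => interactionEnergy V x.1))
    (hx : IsGroundState V x) : IsHardCoreGSC V (Set.range x) := by
  classical
  intro n y z hy hz hyX hdisj
  -- the indices of the removed particles
  choose e he using fun i => hyX (Set.mem_range_self (f := y) i)
  have hei : Function.Injective e := fun i j h => hy (by rw [← he i, ← he j, h])
  have hnot : ∀ j, j ∉ Finset.univ.map ⟨e, hei⟩ → ¬∃ a, e a = j := fun j hj ⟨a, ha⟩ =>
    hj (Finset.mem_map.2 ⟨a, Finset.mem_univ a, ha⟩)
  have hoffmem : ∀ j, (¬∃ a, e a = j) → x j ∈ Set.range x \ Set.range y := fun j hj =>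
    ⟨Set.mem_range_self j, fun ⟨i, hi⟩ => hj ⟨i, hx.1 ((he i).trans hi)⟩⟩
  -- the remaining particles are those with indices off `e(Fin n)`
  have hrest : Set.range x \ Set.range y = x '' ↑((Finset.univ.map ⟨e, hei⟩)ᶜ) := by
    ext q
    constructor
    · rintro ⟨⟨j, rfl⟩, hq⟩
      refine ⟨j, ?_, rfl⟩
      rw [Finset.coe_compl, Set.mem_compl_iff, Finset.mem_coe]
      intro hjT
      obtain ⟨a, -, ha⟩ := Finset.mem_map.1 hjT
      exact hq ⟨a, by rw [← he a]; exact congrArg x ha⟩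
    · rintro ⟨j, hj, rfl⟩
      rw [Finset.coe_compl, Set.mem_compl_iff, Finset.mem_coe] at hj
      exact hoffmem j (hnot j hj)
  -- the competitor: `z` on the indices `e(Fin n)`, `x` elsewhere; it consists of distinct points
  have hinj' : Function.Injective (Function.extend e z x) := by
    intro j₁ j₂ hj
    by_cases h₁ : ∃ a, e a = j₁ <;> by_cases h₂ : ∃ a, e a = j₂
    · obtain ⟨a, rfl⟩ := h₁
      obtain ⟨b, rfl⟩ := h₂
      rw [hei.extend_apply, hei.extend_apply] at hj
      rw [hz hj]
    · obtain ⟨a, rfl⟩ := h₁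
      rw [hei.extend_apply, Function.extend_apply' _ _ _ h₂] at hj
      have hza : z a ∈ Set.range x \ Set.range y := by rw [hj]; exact hoffmem j₂ h₂
      exact absurd hza (Set.disjoint_left.1 hdisj (Set.mem_range_self a))
    · obtain ⟨b, rfl⟩ := h₂
      rw [Function.extend_apply' _ _ _ h₁, hei.extend_apply] at hj
      have hzb : z b ∈ Set.range x \ Set.range y := by rw [← hj]; exact hoffmem j₁ h₁
      exact absurd hzb (Set.disjoint_left.1 hdisj (Set.mem_range_self b))
    · rw [Function.extend_apply' _ _ _ h₁, Function.extend_apply' _ _ _ h₂] at hj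
      exact hx.1 hj
  have hmin : interactionEnergy V x ≤ interactionEnergy V (Function.extend e z x) := by
    rw [hx.2]
    exact groundStateEnergy_le V hb hinj'
  -- energies of `x` and of the competitor, split along `e(Fin n)` and its complement
  have h1 := two_mul_interactionEnergy_exchange V x x y ⟨e, hei⟩ he (fun j _ => rfl)
  have h2 := two_mul_interactionEnergy_exchange V x (Function.extend e z x) z ⟨e, hei⟩
    (fun a => hei.extend_apply z x a) (fun j hj => Function.extend_apply' z x j (hnot j hj))
  -- the field terms are finite sums over the remaining particles
  have hfield : ∀ w : Fin n → EuclideanSpace ℝ (Fin d),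
      ∑ i, ∑' q : ↥(Set.range x \ Set.range y), V (dist (w i) q) =
        ∑ i, ∑ j ∈ (Finset.univ.map ⟨e, hei⟩)ᶜ, V (dist (w i) (x j)) := by
    intro w
    refine Finset.sum_congr rfl fun i _ => ?_
    rw [tsum_congr_set_coe (fun q => V (dist (w i) q)) hrest,
      tsum_image (fun q => V (dist (w i) q)) hx.1.injOn,
      Finset.tsum_subtype' _ (fun j => V (dist (w i) (x j)))]
  rw [hfield y, hfield z]
  linarith [hmin, h1, h2]

/-- For a pair potential bounded below, the point set of every finite ground state is a
hard-core GSC (e.g. Lennard-Jones ground states, `neg_one_div_le_lennardJones`). [folklore] -/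
theorem IsGroundState.isHardCoreGSC_range_of_le {c : ℝ} (hc : ∀ r, c ≤ V r)
    {x : Fin N → EuclideanSpace ℝ (Fin d)} (hx : IsGroundState V x) :
    IsHardCoreGSC V (Set.range x) :=
  hx.isHardCoreGSC_range V
    ⟨_, by rintro _ ⟨x', rfl⟩; exact le_interactionEnergy_of_le V hc x'.1⟩

end GroundState

end Literature.MathematicalPhysics.StatisticalMechanics

end
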